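import Literature.NumberTheory.LFunctions.WeilMarkovQuadratic
import Mathlib.MeasureTheory.Integral.IntervalIntegral.Slope

/-!
# Auxiliary toolkit (part 1) for sub-stub `stub_edgeLaw_barrier` (line `cut-dont-squeeze`)

The two-scale profile of the edge-law barrier for the crux `WeilWindowFlow.WindowLipschitz`
(item stmt-RiemannHypothesis-1039): for a scale `0 < d₀ ≤ 1/16` put
`V(s) = (log(1/min(s, d₀)))^(-1/2)` (the barrier is `B(x) = V(a − |x|) 1_{|x| < a}`, part 2).
This file proves the pointwise bookkeeping of `V` (values in `(0, β₀]`, `β₀ = (log 1/d₀)^(-1/2) ≤ 1`;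
monotonicity on `(0, ∞)`; plateau value `β₀` on `[d₀, ∞)`; layer formula; the difference bound
`V(s₂) − V(s₁) ≤ (s₂ − s₁)/s₁`; measurability) and of the monotone one-sided profile
`G = 1_{(0,∞)} V` (monotone on `ℝ`, `0` on `(−∞, 0]`, `β₀` on `[d₀, ∞)`), and the TELESCOPING bound
`∫ (G(x+t) − G(x)) dx ≤ β₀ t` (`MonotoneOn.intervalIntegral_slope_le`), which drives the
bounded-variation estimate `D_t(B) ≤ 2β₀² t` of the barrier's increments in part 2.

Main (registered) statement: `stub_edgeLaw_barrier_telescope`.  Folklore real analysis over Mathlib.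
-/

set_option linter.dupNamespace false

noncomputable section

open MeasureTheory Set Filter
open scoped Topology ENNReal NNReal ComplexConjugate

namespace Summit.RiemannHypothesis.RiemannHypothesis.Theorems.WeilWindowFlowWindowLipschitz

open Literature.NumberTheory.LFunctions

/-! ## The two-scale profile `V(s) = (log(1/min(s,d₀)))^(-1/2)` -/

section Profile

variable {d₀ : ℝ} {V : ℝ → ℝ}

/-- For `0 < m ≤ d₀ ≤ 1/16`: `1 ≤ log(1/m)` (`e ≤ 16`). -/
theorem stub_edgeLaw_barrier_one_le_log (hd₀' : d₀ ≤ 1 / 16) {m : ℝ} (hm : 0 < m)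
    (hmd : m ≤ d₀) : 1 ≤ Real.log (1 / m) := by
  rw [Real.le_log_iff_exp_le (by positivity)]
  have h1 : Real.exp 1 ≤ 16 := by
    have h := Real.exp_one_lt_d9
    norm_num at h
    linarith
  calc Real.exp 1 ≤ 16 := h1
    _ ≤ 1 / d₀ := by
        rw [le_div_iff₀ (hm.trans_le hmd)]
        linarith
    _ ≤ 1 / m := one_div_le_one_div_of_le hm hmd

/-- `0 < V(s) ≤ β₀ = (log 1/d₀)^(-1/2)` for `s > 0`. -/
theorem stub_edgeLaw_barrier_V_pos_le (hd₀ : 0 < d₀) (hd₀' : d₀ ≤ 1 / 16)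
    (hV : ∀ s, V s = (Real.sqrt (Real.log (1 / min s d₀)))⁻¹) {s : ℝ} (hs : 0 < s) :
    0 < V s ∧ V s ≤ (Real.sqrt (Real.log (1 / d₀)))⁻¹ := by
  have hm0 : 0 < min s d₀ := lt_min hs hd₀
  have hm1 : min s d₀ ≤ d₀ := min_le_right _ _
  have hL : 1 ≤ Real.log (1 / min s d₀) := stub_edgeLaw_barrier_one_le_log hd₀' hm0 hm1
  have hL₀ : 1 ≤ Real.log (1 / d₀) := stub_edgeLaw_barrier_one_le_log hd₀' hd₀ le_rfl
  rw [hV]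
  refine ⟨inv_pos.2 (Real.sqrt_pos.2 (by linarith)), ?_⟩
  refine inv_anti₀ (Real.sqrt_pos.2 (by linarith)) (Real.sqrt_le_sqrt ?_)
  exact Real.log_le_log (one_div_pos.2 hd₀) (one_div_le_one_div_of_le hm0 hm1)

/-- `β₀ = (log 1/d₀)^(-1/2) ∈ (0, 1]`. -/
theorem stub_edgeLaw_barrier_beta_pos_le (hd₀ : 0 < d₀) (hd₀' : d₀ ≤ 1 / 16) :
    0 < (Real.sqrt (Real.log (1 / d₀)))⁻¹ ∧ (Real.sqrt (Real.log (1 / d₀)))⁻¹ ≤ 1 := by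
  have hL₀ : 1 ≤ Real.log (1 / d₀) := stub_edgeLaw_barrier_one_le_log hd₀' hd₀ le_rfl
  have h1 : 1 ≤ Real.sqrt (Real.log (1 / d₀)) := by
    simpa using Real.sqrt_le_sqrt hL₀
  exact ⟨inv_pos.2 (by linarith), inv_le_one_of_one_le₀ h1⟩

/-- `V` is non-decreasing on `(0, ∞)`. -/
theorem stub_edgeLaw_barrier_V_mono (hd₀ : 0 < d₀) (hd₀' : d₀ ≤ 1 / 16)
    (hV : ∀ s, V s = (Real.sqrt (Real.log (1 / min s d₀)))⁻¹) {s₁ s₂ : ℝ} (hs₁ : 0 < s₁)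
    (h : s₁ ≤ s₂) : V s₁ ≤ V s₂ := by
  have hm0 : 0 < min s₁ d₀ := lt_min hs₁ hd₀
  have hmm : min s₁ d₀ ≤ min s₂ d₀ := min_le_min_right _ h
  have hm2 : min s₂ d₀ ≤ d₀ := min_le_right _ _
  have hL2 : 1 ≤ Real.log (1 / min s₂ d₀) :=
    stub_edgeLaw_barrier_one_le_log hd₀' (hm0.trans_le hmm) hm2
  rw [hV, hV]
  refine inv_anti₀ (Real.sqrt_pos.2 (by linarith)) (Real.sqrt_le_sqrt ?_)
  exact Real.log_le_log (one_div_pos.2 (hm0.trans_le hmm)) (one_div_le_one_div_of_le hm0 hmm)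

/-- On the plateau `s ≥ d₀`: `V(s) = β₀`. -/
theorem stub_edgeLaw_barrier_V_plateau
    (hV : ∀ s, V s = (Real.sqrt (Real.log (1 / min s d₀)))⁻¹) {s : ℝ} (hs : d₀ ≤ s) :
    V s = (Real.sqrt (Real.log (1 / d₀)))⁻¹ := by
  rw [hV, min_eq_right hs]

/-- On the layer `s ≤ d₀`: `V(s) = (log 1/s)^(-1/2)`. -/
theorem stub_edgeLaw_barrier_V_layer
    (hV : ∀ s, V s = (Real.sqrt (Real.log (1 / min s d₀)))⁻¹) {s : ℝ} (hs : s ≤ d₀) :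
    V s = (Real.sqrt (Real.log (1 / s)))⁻¹ := by
  rw [hV, min_eq_left hs]

/-- `V` is measurable. -/
theorem stub_edgeLaw_barrier_V_measurable
    (hV : ∀ s, V s = (Real.sqrt (Real.log (1 / min s d₀)))⁻¹) : Measurable V := by
  have e : V = fun s ↦ (Real.sqrt (Real.log (1 / min s d₀)))⁻¹ := funext hV
  rw [e]
  exact ((measurable_const.div (measurable_id.min measurable_const)).log.sqrt).inv

/-- **Difference bound** `V(s₂) − V(s₁) ≤ (s₂ − s₁)/s₁` for `0 < s₁ ≤ s₂`
(`u^(-1/2)` is `1`-Lipschitz in `u = log(1/m) ≥ 1`, and `log(m₂/m₁) ≤ m₂/m₁ − 1`). -/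
theorem stub_edgeLaw_barrier_V_lip (hd₀ : 0 < d₀) (hd₀' : d₀ ≤ 1 / 16)
    (hV : ∀ s, V s = (Real.sqrt (Real.log (1 / min s d₀)))⁻¹) {s₁ s₂ : ℝ} (hs₁ : 0 < s₁)
    (h : s₁ ≤ s₂) : V s₂ - V s₁ ≤ (s₂ - s₁) / s₁ := by
  set m₁ := min s₁ d₀ with hm₁
  set m₂ := min s₂ d₀ with hm₂
  have hm₁0 : 0 < m₁ := lt_min hs₁ hd₀
  have hmm : m₁ ≤ m₂ := min_le_min_right _ h
  have hm₂0 : 0 < m₂ := hm₁0.trans_le hmm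
  have hm₂d : m₂ ≤ d₀ := min_le_right _ _
  set u₁ := Real.log (1 / m₁) with hu₁
  set u₂ := Real.log (1 / m₂) with hu₂
  have hu₂1 : 1 ≤ u₂ := stub_edgeLaw_barrier_one_le_log hd₀' hm₂0 hm₂d
  have hu₁₂ : u₂ ≤ u₁ := Real.log_le_log (one_div_pos.2 hm₂0) (one_div_le_one_div_of_le hm₁0 hmm)
  have hb : 1 ≤ Real.sqrt u₂ := by
    simpa using Real.sqrt_le_sqrt hu₂1
  have hab : Real.sqrt u₂ ≤ Real.sqrt u₁ := Real.sqrt_le_sqrt hu₁₂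
  have hb0 : 0 < Real.sqrt u₂ := by linarith
  have ha0 : 0 < Real.sqrt u₁ := by linarith
  have hV2 : V s₂ = (Real.sqrt u₂)⁻¹ := by rw [hV]
  have hV1 : V s₁ = (Real.sqrt u₁)⁻¹ := by rw [hV]
  have step1 : (Real.sqrt u₂)⁻¹ - (Real.sqrt u₁)⁻¹ ≤ u₁ - u₂ := by
    rw [inv_sub_inv hb0.ne' ha0.ne', div_le_iff₀ (mul_pos hb0 ha0)]
    have hsq1 : Real.sqrt u₁ ^ 2 = u₁ := Real.sq_sqrt (by linarith)
    have hsq2 : Real.sqrt u₂ ^ 2 = u₂ := Real.sq_sqrt (by linarith)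
    have hprod : 1 ≤ (Real.sqrt u₁ + Real.sqrt u₂) * (Real.sqrt u₂ * Real.sqrt u₁) := by
      nlinarith
    nlinarith [mul_nonneg (sub_nonneg.2 hab) (sub_nonneg.2 hprod)]
  have step2 : u₁ - u₂ ≤ (m₂ - m₁) / m₁ := by
    have e : u₁ - u₂ = Real.log (m₂ / m₁) := by
      rw [hu₁, hu₂, Real.log_div hm₂0.ne' hm₁0.ne', one_div, one_div, Real.log_inv, Real.log_inv]
      ring
    rw [e, ← div_sub_one hm₁0.ne']
    exact Real.log_le_sub_one_of_pos (div_pos hm₂0 hm₁0)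
  have step3 : (m₂ - m₁) / m₁ ≤ (s₂ - s₁) / s₁ := by
    rcases le_or_gt s₁ d₀ with h1 | h1
    · have e1 : m₁ = s₁ := min_eq_left h1
      have e2 : m₂ ≤ s₂ := min_le_left _ _
      rw [e1]
      gcongr
    · have e1 : m₁ = d₀ := min_eq_right h1.le
      have e2 : m₂ = d₀ := min_eq_right (h1.le.trans h)
      rw [e1, e2, sub_self, zero_div]
      exact div_nonneg (sub_nonneg.2 h) hs₁.le
  rw [hV2, hV1]
  linarith

/-! ## The monotone one-sided profile `G = 1_{(0,∞)} · V` -/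

variable {G : ℝ → ℝ}

/-- `0 ≤ G ≤ β₀`. -/
theorem stub_edgeLaw_barrier_G_nonneg_le (hd₀ : 0 < d₀) (hd₀' : d₀ ≤ 1 / 16)
    (hV : ∀ s, V s = (Real.sqrt (Real.log (1 / min s d₀)))⁻¹)
    (hG : ∀ s, G s = if 0 < s then V s else 0) (s : ℝ) :
    0 ≤ G s ∧ G s ≤ (Real.sqrt (Real.log (1 / d₀)))⁻¹ := by
  rw [hG]
  split_ifs with hs
  · have h := stub_edgeLaw_barrier_V_pos_le hd₀ hd₀' hV hs
    exact ⟨h.1.le, h.2⟩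
  · exact ⟨le_rfl, inv_nonneg.2 (Real.sqrt_nonneg _)⟩

/-- `G` is monotone on `ℝ`. -/
theorem stub_edgeLaw_barrier_G_monotone (hd₀ : 0 < d₀) (hd₀' : d₀ ≤ 1 / 16)
    (hV : ∀ s, V s = (Real.sqrt (Real.log (1 / min s d₀)))⁻¹)
    (hG : ∀ s, G s = if 0 < s then V s else 0) : Monotone G := by
  intro s₁ s₂ h
  rw [hG, hG]
  split_ifs with h1 h2 h2
  · exact stub_edgeLaw_barrier_V_mono hd₀ hd₀' hV h1 h
  · exact absurd (h1.trans_le h) h2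
  · exact (stub_edgeLaw_barrier_V_pos_le hd₀ hd₀' hV h2).1.le
  · exact le_rfl

/-- `G = 0` on `(-∞, 0]`. -/
theorem stub_edgeLaw_barrier_G_nonpos (hG : ∀ s, G s = if 0 < s then V s else 0) {s : ℝ}
    (hs : s ≤ 0) : G s = 0 := by
  rw [hG, if_neg (not_lt.2 hs)]

/-- `G = β₀` on `[d₀, ∞)`. -/
theorem stub_edgeLaw_barrier_G_plateau (hd₀ : 0 < d₀)
    (hV : ∀ s, V s = (Real.sqrt (Real.log (1 / min s d₀)))⁻¹)
    (hG : ∀ s, G s = if 0 < s then V s else 0) {s : ℝ} (hs : d₀ ≤ s) :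
    G s = (Real.sqrt (Real.log (1 / d₀)))⁻¹ := by
  rw [hG, if_pos (hd₀.trans_le hs), stub_edgeLaw_barrier_V_plateau hV hs]

/-- **Telescoping.** For `t ≥ 0` the increment `x ↦ G(x+t) − G(x)` is integrable and
`∫ (G(x+t) − G(x)) dx ≤ β₀ t` (it vanishes off `(-t, d₀]`; `MonotoneOn.intervalIntegral_slope_le`). -/
theorem stub_edgeLaw_barrier_G_tele (hd₀ : 0 < d₀) (hd₀' : d₀ ≤ 1 / 16)
    (hV : ∀ s, V s = (Real.sqrt (Real.log (1 / min s d₀)))⁻¹)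
    (hG : ∀ s, G s = if 0 < s then V s else 0) {t : ℝ} (ht : 0 ≤ t) :
    Integrable (fun x ↦ G (x + t) - G x) ∧
      ∫ x, (G (x + t) - G x) ≤ (Real.sqrt (Real.log (1 / d₀)))⁻¹ * t := by
  have hmono := stub_edgeLaw_barrier_G_monotone hd₀ hd₀' hV hG
  have hzero : ∀ x, x ∉ Ioc (-t) d₀ → G (x + t) - G x = 0 := by
    intro x hx
    rcases le_or_gt x (-t) with h1 | h1
    · rw [stub_edgeLaw_barrier_G_nonpos hG (by linarith : x + t ≤ 0),
        stub_edgeLaw_barrier_G_nonpos hG (by linarith : x ≤ 0), sub_self]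
    · have h2 : d₀ < x := by
        by_contra h2
        exact hx ⟨h1, not_lt.1 h2⟩
      rw [stub_edgeLaw_barrier_G_plateau hd₀ hV hG (by linarith : d₀ ≤ x + t),
        stub_edgeLaw_barrier_G_plateau hd₀ hV hG h2.le, sub_self]
  have hbound : ∀ x, ‖G (x + t) - G x‖ ≤ (Real.sqrt (Real.log (1 / d₀)))⁻¹ := by
    intro x
    have h1 := stub_edgeLaw_barrier_G_nonneg_le hd₀ hd₀' hV hG (x + t)
    have h2 := stub_edgeLaw_barrier_G_nonneg_le hd₀ hd₀' hV hG x
    rw [Real.norm_eq_abs]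
    exact abs_sub_le_iff.2 ⟨by linarith, by linarith⟩
  have hmeas : Measurable (fun x ↦ G (x + t) - G x) :=
    (hmono.measurable.comp (measurable_id.add_const t)).sub hmono.measurable
  have hint : Integrable (fun x ↦ G (x + t) - G x) := by
    have h1 : IntegrableOn (fun x ↦ G (x + t) - G x) (Ioc (-t) d₀) :=
      Measure.integrableOn_of_bounded measure_Ioc_lt_top.ne hmeas.aestronglyMeasurable
        (ae_of_all _ hbound)
    exact h1.integrable_of_forall_notMem_eq_zero hzero
  refine ⟨hint, ?_⟩
  rw [← setIntegral_eq_integral_of_forall_compl_eq_zero hzero,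
    ← intervalIntegral.integral_of_le (by linarith : -t ≤ d₀)]
  rcases ht.eq_or_lt with rfl | ht'
  · simp
  have key := (hmono.monotoneOn (Icc (-t) (d₀ + t))).intervalIntegral_slope_le
    (by linarith : -t ≤ d₀) ht
  have e : (fun x ↦ G (x + t) - G x) = fun x ↦ t * slope G x (x + t) := by
    funext x
    rw [slope_def_field, add_sub_cancel_left]
    field_simp
  rw [e, intervalIntegral.integral_const_mul]
  calc t * ∫ x in (-t)..d₀, slope G x (x + t) ≤ t * (G (d₀ + t) - G (-t)) :=
        mul_le_mul_of_nonneg_left key ht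
    _ = (Real.sqrt (Real.log (1 / d₀)))⁻¹ * t := by
        rw [stub_edgeLaw_barrier_G_plateau hd₀ hV hG (by linarith : d₀ ≤ d₀ + t),
          stub_edgeLaw_barrier_G_nonpos hG (by linarith : -t ≤ 0)]
        ring

/-- **Registered sub-stub `stub_edgeLaw_barrier_telescope`** (aux of `stub_edgeLaw_barrier`): the
bounded-variation telescoping bound for the monotone one-sided profile `G = 1_{(0,∞)} V` of the
two-scale barrier: for `t ≥ 0`, `x ↦ G(x+t) − G(x)` is integrable and `∫ (G(x+t) − G(x)) dx ≤ β₀ t`,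
`β₀ = (log 1/d₀)^(-1/2)`. -/
theorem stub_edgeLaw_barrier_telescope :
    ∀ (d₀ t : ℝ) (V G : ℝ → ℝ), 0 < d₀ → d₀ ≤ 1 / 16 →
      (∀ s, V s = (Real.sqrt (Real.log (1 / min s d₀)))⁻¹) →
      (∀ s, G s = if 0 < s then V s else 0) → 0 ≤ t →
      Integrable (fun x ↦ G (x + t) - G x) ∧
        ∫ x, (G (x + t) - G x) ≤ (Real.sqrt (Real.log (1 / d₀)))⁻¹ * t :=
  fun _ _ _ _ hd₀ hd₀' hV hG ht ↦ stub_edgeLaw_barrier_G_tele hd₀ hd₀' hV hG ht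

end Profile

end Summit.RiemannHypothesis.RiemannHypothesis.Theorems.WeilWindowFlowWindowLipschitz

end
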